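import Summits.BirchSwinnertonDyer.BirchSwinnertonDyer.Theorems.GenusKolyvaginAtTwoOffCutResidualAtTwoRLw2PhantomExclusionRat
import Summits.BirchSwinnertonDyer.BirchSwinnertonDyer.Theorems.GenusKolyvaginAtTwoOffCutResidualAtTwoRLw2PhantomExclusionSelmer
import Summits.BirchSwinnertonDyer.BirchSwinnertonDyer.Theorems.GenusKolyvaginAtTwoEquivariantKolyvaginExactAtTwoSelmerConditionVisible
import Summits.BirchSwinnertonDyer.BirchSwinnertonDyer.Theorems.GenusKolyvaginAtTwoEquivariantKolyvaginExactAtTwoArchimedeanSelmerLevel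
import Summits.BirchSwinnertonDyer.BirchSwinnertonDyer.Theorems.GenusKolyvaginAtTwoGenusPrimitiveSupplyAtTwoTwistingPrimeDepthTwoInflation
import HarnessLib

/-!
# Route `GenusKolyvaginAtTwo`, residual `OffCutResidualAtTwoR` (stmt-BirchSwinnertonDyer-31767), LINE 26 «lw2_phantom_exclusion»:
# THE DICHOTOMY OVER `ℚ` — for `Δ < 0` on a `2`-split Heegner frame, `(NPh_M)` for every `M ≥ 1` ⟺ the Lawson–Wuthrich class `ξ` is NOT a
# rational `2`-Selmer class of `E`

Width seat `bsd-line-gk2-p4` g31 (cell `bsd-f1-sign2`), `--supports stmt-BirchSwinnertonDyer-31767 --as helper`.  THEOREMS ONLY (no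
definition, no named fact, no `sorry`).  **BSD is NOT proved by this file; nothing is closed by it alone.**

WHAT.  `…Lw2PhantomExclusionRat` (p781512) put the engine hypothesis `(NPh)` over the Heegner field `K` in `E`-intrinsic form — on a Heegner frame with
`2` split, `(NPh_M)(W,K) ∀ M` ⟺ the level-`4` class `ξ ∈ H¹(ℚ, E[2])` (g10) fails the Kummer condition at some prime `p ∣ 2N` OVER `ℚ`.  Over `ℚ` a class
dying on `Γ_{ℚ(E[4])}` is AUTOMATICALLY Kummer at every prime `p ∤ 2N` (good reduction + Néron–Ogg–Shafarevich + level stability, as over `K` in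
`…Lw2PhantomExclusionSelmer`) and, when `Δ < 0`, at the real place (`H¹(ℝ, E) = 0`: gk2's `ArchVanishing.mem_selmerLocalKer_infinitePlace_of_Δ_neg`):
* `mem_selmerLocalKer_rat_of_forall_torsionFixing_four_of_notMem` — `p ∤ 2N` ⟹ Kummer at `p`;
* `mem_selmerGroup_rat_iff_forall_mem_two_mul_of_Δ_neg` — `Δ < 0`: such a class is in `Sel₂(E/ℚ)` iff it is Kummer at every `p ∣ 2N`;
* ★ `nonPhantom_pow_iff_forall_notMem_selmerGroup_rat` — **`Δ < 0`, frame `2`-split Heegner: `(NPh_M)(W, K)` for every `M ≥ 1` ⟺ `x ∉ Sel₂(E/ℚ)` for every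
  non-zero `x ∈ H¹(ℚ, E[2])` dying on `Γ_{ℚ(E[4])}`** (there is exactly one, `ξ`: g10 `existsUnique_…`); sign-free companion
  `nonPhantom_pow_iff_exists_finite_place_rat` (any `Δ`): ⟺ `ξ` fails the Kummer condition at some FINITE prime.
READING for the planners (LINE 28's 22 `Δ < 0`, `#Ш_an = 4` cells, «verdict NO ⟺ ξ ∈ Sel₂(E)»): on `Δ < 0` cells the reach of every `(NPh)`-fed line at
any `2`-split Heegner frame is EXACTLY «the Lawson–Wuthrich `2`-covering is not everywhere locally soluble» — a rational `2`-descent datum of `E`, no `K`.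
BSD is NOT proved by any of this.

References: [LawsonWuthrich2016] §3, §7.1, §8; [GrossLMS1991] §7, §9; [SilvermanAEC2009] VII.4.1, X.4.4; [MilneADT2006] I Rem. 3.7, Prop. 3.8.
-/

set_option autoImplicit false
-- the Theorems namespace of this sub repeats the summit name by design (D-0017 nested layout)
set_option linter.dupNamespace false

noncomputable section

open scoped Classical NumberField

namespace Summit.BirchSwinnertonDyer.BirchSwinnertonDyer.Theorems.GenusExact.Lw2PhantomExclusion

open WeierstrassCurve NumberField Field IsDedekindDomain
open Literature.NumberTheory.EllipticCurves Literature.NumberTheory.GaloisRepresentations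
open Summit.BirchSwinnertonDyer.BirchSwinnertonDyer.Theorems.KolyvaginLowerBoundAtTwo (torsionFixing_le_of_dvd)

variable (W : WeierstrassCurve ℚ) [W.IsElliptic]

/-! ## §1 Off `2N` a class of `H¹(ℚ, E[2])` dying on `Γ_{ℚ(E[4])}` is Kummer -/

/-- ★ **Off `2N`, a class of `H¹(ℚ, E[2])` dying on `Γ_{ℚ(E[4])}` is Kummer**: `v ∌ 2N_E` is a place of good reduction not over `2`, inertia at `v`
fixes `E[4]` (Néron–Ogg–Shafarevich), the lift `ι_{1→2} z ∈ H¹(ℚ, E[4])` vanishes on it — the Selmer condition at a good `v ∤ 4` (Gross (7.1)/(7.4)) —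
and the Selmer condition is level-stable. [cite: GrossLMS1991, §7 (7.1), (7.4)] [cite: SilvermanAEC2009, Prop. VII.4.1, Cor. X.4.4] -/
theorem mem_selmerLocalKer_rat_of_forall_torsionFixing_four_of_notMem (v : HeightOneSpectrum (𝓞 ℚ))
    (hv : ((2 * W.conductorNorm ℤ : ℕ) : 𝓞 ℚ) ∉ v.asIdeal) {z : galH1Torsion W (2 : ℤ)}
    (hz : ∀ ρ ∈ torsionFixing W (4 : ℤ), h1Eval W (2 : ℤ) z ρ = 0) :
    z ∈ selmerLocalKer W (v.adicCompletion ℚ) (2 : ℤ) := by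
  have h2v : ((2 : ℕ) : 𝓞 ℚ) ∉ v.asIdeal := fun h ↦ hv (by rw [Nat.cast_mul]; exact v.asIdeal.mul_mem_right _ h)
  have hNv : ((W.conductorNorm ℤ : ℕ) : 𝓞 ℚ) ∉ v.asIdeal := fun h ↦ hv (by rw [Nat.cast_mul]; exact v.asIdeal.mul_mem_left _ h)
  have hgood : W.HasGoodReductionAt v := hasGoodReductionAt_of_natCast_conductorNorm_notMem W v hNv
  have h12 : (2 : ℤ) ∣ ((2 ^ 2 : ℕ) : ℤ) := ⟨2, by norm_num⟩
  have h4v : ((((2 ^ 2 : ℕ) : ℤ)) : 𝓞 ℚ) ∉ v.asIdeal := by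
    intro h
    have h' : ((2 : ℕ) : 𝓞 ℚ) * ((2 : ℕ) : 𝓞 ℚ) ∈ v.asIdeal := by
      have e : ((((2 ^ 2 : ℕ) : ℤ)) : 𝓞 ℚ) = ((2 : ℕ) : 𝓞 ℚ) * ((2 : ℕ) : 𝓞 ℚ) := by push_cast; norm_num
      rw [← e]; exact h
    rcases v.isPrime.mem_or_mem h' with h2 | h2 <;> exact h2v h2
  have hιz : ∀ ρ ∈ torsionFixing W ((2 ^ 2 : ℕ) : ℤ), h1Eval W _ (torsionH1OfDvd W h12 z) ρ = 0 := by
    have e : ((2 ^ 2 : ℕ) : ℤ) = 4 := by norm_num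
    intro ρ hρ
    refine (h1Eval_torsionH1OfDvd_eq_zero_iff W h12 z hρ).mpr (hz ρ ?_)
    rw [← e]; exact hρ
  obtain ⟨𝔓, h𝔓⟩ := v.primesAbove_nonempty
  have hι : torsionH1OfDvd W h12 z ∈ selmerLocalKer W (v.adicCompletion ℚ) ((2 ^ 2 : ℕ) : ℤ) :=
    (SelmerDescent.mem_selmerLocalKer_iff_forall_h1Eval_eq_zero W v hgood h4v h𝔓 _).mpr fun τ hτ ↦
      hιz τ (SelmerDescent.inertia_le_torsionFixing_of_hasGoodReductionAt W v hgood h4v h𝔓 hτ)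
  exact (RelaxedCount.torsionH1OfDvd_mem_selmerLocalKer_iff_mem W h12 (v.adicCompletion ℚ) z).mp hι

/-- **`Δ < 0`: a class of `H¹(ℚ, E[2])` dying on `Γ_{ℚ(E[4])}` is `2`-Selmer iff it is Kummer at the primes over `2N`** (§1 off `2N`; the real place
imposes nothing when `Δ < 0`, `ArchVanishing.mem_selmerLocalKer_infinitePlace_of_Δ_neg`). [cite: MilneADT2006, I Rem. 3.7] [cite: GrossLMS1991, §7 (7.4)] -/
theorem mem_selmerGroup_rat_iff_forall_mem_two_mul_of_Δ_neg (hΔ : W.Δ < 0) {z : galH1Torsion W (2 : ℤ)}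
    (hz : ∀ ρ ∈ torsionFixing W (4 : ℤ), h1Eval W (2 : ℤ) z ρ = 0) :
    z ∈ selmerGroup W (2 : ℤ) ↔
      ∀ v : HeightOneSpectrum (𝓞 ℚ), ((2 * W.conductorNorm ℤ : ℕ) : 𝓞 ℚ) ∈ v.asIdeal → z ∈ selmerLocalKer W (v.adicCompletion ℚ) (2 : ℤ) := by
  rw [WeierstrassCurve.mem_selmerGroup_iff]
  constructor
  · rintro ⟨hfin, -⟩ v _
    exact hfin v
  · intro h
    refine ⟨fun v ↦ ?_, fun w ↦ ArchVanishing.mem_selmerLocalKer_infinitePlace_of_Δ_neg W w hΔ (2 : ℤ) z⟩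
    by_cases hv : ((2 * W.conductorNorm ℤ : ℕ) : 𝓞 ℚ) ∈ v.asIdeal
    · exact h v hv
    · exact mem_selmerLocalKer_rat_of_forall_torsionFixing_four_of_notMem W v hv hz

/-! ## §2 The dichotomy over `ℚ` -/

/-- **Sign-free form: `(NPh)` ⟺ `ξ` fails the Kummer condition at some FINITE prime of `ℚ`.**  Frame: `ρ_{E,2^n}` onto over `ℚ` for all `n`; `K` imaginary
quadratic, `d_K` odd, `d_K·(−|Δ|)`, `d_K·(−2|Δ|)` non-squares, Heegner for `N ≠ 0`, `2` split in `K`.  Then `(NPh_M)(W, K)` for every `M ≥ 1` ⟺ every non-zero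
`x ∈ H¹(ℚ, E[2])` dying on `Γ_{ℚ(E[4])}` fails the Kummer condition at SOME finite place of `ℚ` (necessarily over `2N`, by §1).  (`…Rat`'s criterion + §1 +
uniqueness of `ξ`, g10 `GenusKolyTwistingPrime.eq_of_forall_torsionFixing_four_h1Eval_eq_zero`.) [cite: LawsonWuthrich2016, §3, §7.1, §8] [cite: GrossLMS1991, §9] -/
theorem nonPhantom_pow_iff_exists_finite_place_rat {K : Type} [Field K] [NumberField K]
    (hρ : ∀ n : ℕ, 0 < n → W.HasSurjectiveModNGaloisRep ((2 : ℤ) ^ n)) (hK : IsImaginaryQuadratic K)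
    (hodd : Odd (NumberField.discr K)) (hnsq₁ : ¬ IsSquare ((NumberField.discr K : ℚ) * -|W.Δ|))
    (hnsq₂ : ¬ IsSquare ((NumberField.discr K : ℚ) * (-(2 * |W.Δ|)))) (hN : W.conductorNorm ℤ ≠ 0)
    (hH : SatisfiesHeegnerHypothesis (W.conductorNorm ℤ) K) (h2 : ((Ideal.span {(2 : ℤ)}).primesOver (𝓞 K)).ncard = 2) :
    (∀ (Mlev : ℕ), 1 ≤ Mlev → ∀ z : galH1Torsion (W.baseChange K) ((2 ^ Mlev : ℕ) : ℤ),
        (∀ ρ ∈ torsionFixing (W.baseChange K) ((2 ^ Mlev : ℕ) : ℤ), h1Eval (W.baseChange K) ((2 ^ Mlev : ℕ) : ℤ) z ρ = 0) →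
        (∀ w : HeightOneSpectrum (𝓞 K), ((2 * W.conductorNorm ℤ : ℕ) : 𝓞 K) ∈ w.asIdeal →
          z ∈ selmerLocalKer (W.baseChange K) (w.adicCompletion K) ((2 ^ Mlev : ℕ) : ℤ)) → z = 0) ↔
      ∀ x : galH1Torsion W (2 : ℤ), x ≠ 0 → (∀ h ∈ torsionFixing W (4 : ℤ), h1Eval W (2 : ℤ) x h = 0) →
        ∃ v : HeightOneSpectrum (𝓞 ℚ), x ∉ selmerLocalKer W (v.adicCompletion ℚ) (2 : ℤ) := by
  rw [nonPhantom_pow_iff_levelTwoWitness_rat W hρ hK hodd hnsq₁ hnsq₂ hN hH h2]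
  have hρ2 : W.HasSurjectiveModNGaloisRep 2 := by simpa using hρ 1 one_pos
  have hρ4 : W.HasSurjectiveModNGaloisRep 4 := by have h := hρ 2 two_pos; norm_num at h; exact h
  constructor
  · rintro ⟨v, -, hwit⟩ x hx0 hx
    exact ⟨v, hwit x hx0 hx⟩
  · intro hall
    obtain ⟨ξ, hξ0, hξ⟩ := GenusKolyTwistingPrime.exists_ne_zero_forall_torsionFixing_four_h1Eval_eq_zero W hρ4
    obtain ⟨v, hv⟩ := hall ξ hξ0 hξ
    have h2Nv : ((2 * W.conductorNorm ℤ : ℕ) : 𝓞 ℚ) ∈ v.asIdeal := by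
      by_contra h
      exact hv (mem_selmerLocalKer_rat_of_forall_torsionFixing_four_of_notMem W v h hξ)
    refine ⟨v, h2Nv, fun x hx0 hx hxv ↦ hv ?_⟩
    rwa [GenusKolyTwistingPrime.eq_of_forall_torsionFixing_four_h1Eval_eq_zero W hρ2 hρ4 hξ0 hx0 hξ hx]

/-- ★ **`Δ < 0`: `(NPh)` ⟺ THE LAWSON–WUTHRICH CLASS IS NOT A RATIONAL `2`-SELMER CLASS.**  Frame as above, and `Δ_E < 0`.  Then `(NPh_M)(W, K)` for
every `M ≥ 1` ⟺ every non-zero `x ∈ H¹(ℚ, E[2])` dying on `Γ_{ℚ(E[4])}` lies OUTSIDE `Sel₂(E/ℚ)`.  So on the `Δ < 0` cells the reach of every `(NPh)`-fed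
line at any `2`-split Heegner frame is exactly «the level-4 `2`-covering of Lawson–Wuthrich is not everywhere locally soluble» — a datum of rational
`2`-descent on `E` alone (LINE 28's «verdict NO ⟺ ξ ∈ Sel₂(E)» as a theorem shape).  BSD is NOT proved by this. [cite: LawsonWuthrich2016, §3, §7.1 and §8]
[cite: GrossLMS1991, §9 Prop. 9.1] [cite: MilneADT2006, I Rem. 3.7] -/
theorem nonPhantom_pow_iff_forall_notMem_selmerGroup_rat {K : Type} [Field K] [NumberField K]
    (hρ : ∀ n : ℕ, 0 < n → W.HasSurjectiveModNGaloisRep ((2 : ℤ) ^ n)) (hΔ : W.Δ < 0) (hK : IsImaginaryQuadratic K)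
    (hodd : Odd (NumberField.discr K)) (hnsq₁ : ¬ IsSquare ((NumberField.discr K : ℚ) * -|W.Δ|))
    (hnsq₂ : ¬ IsSquare ((NumberField.discr K : ℚ) * (-(2 * |W.Δ|)))) (hN : W.conductorNorm ℤ ≠ 0)
    (hH : SatisfiesHeegnerHypothesis (W.conductorNorm ℤ) K) (h2 : ((Ideal.span {(2 : ℤ)}).primesOver (𝓞 K)).ncard = 2) :
    (∀ (Mlev : ℕ), 1 ≤ Mlev → ∀ z : galH1Torsion (W.baseChange K) ((2 ^ Mlev : ℕ) : ℤ),
        (∀ ρ ∈ torsionFixing (W.baseChange K) ((2 ^ Mlev : ℕ) : ℤ), h1Eval (W.baseChange K) ((2 ^ Mlev : ℕ) : ℤ) z ρ = 0) →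
        (∀ w : HeightOneSpectrum (𝓞 K), ((2 * W.conductorNorm ℤ : ℕ) : 𝓞 K) ∈ w.asIdeal →
          z ∈ selmerLocalKer (W.baseChange K) (w.adicCompletion K) ((2 ^ Mlev : ℕ) : ℤ)) → z = 0) ↔
      ∀ x : galH1Torsion W (2 : ℤ), x ≠ 0 → (∀ h ∈ torsionFixing W (4 : ℤ), h1Eval W (2 : ℤ) x h = 0) → x ∉ selmerGroup W (2 : ℤ) := by
  rw [nonPhantom_pow_iff_exists_finite_place_rat W hρ hK hodd hnsq₁ hnsq₂ hN hH h2]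
  refine forall_congr' fun x ↦ forall_congr' fun hx0 ↦ forall_congr' fun hx ↦ ?_
  rw [mem_selmerGroup_rat_iff_forall_mem_two_mul_of_Δ_neg W hΔ hx]
  constructor
  · rintro ⟨v, hv⟩ hall
    by_cases h2Nv : ((2 * W.conductorNorm ℤ : ℕ) : 𝓞 ℚ) ∈ v.asIdeal
    · exact hv (hall v h2Nv)
    · exact hv (mem_selmerLocalKer_rat_of_forall_torsionFixing_four_of_notMem W v h2Nv hx)
  · intro h
    by_contra hall
    push Not at hall
    exact h fun v _ ↦ hall v

end Summit.BirchSwinnertonDyer.BirchSwinnertonDyer.Theorems.GenusExact.Lw2PhantomExclusion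

end
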